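import Summits.KontsevichZagierPeriods.KontsevichZagierPeriods.Theorems.EffectiveXMapChains.Negative.PeriodRep
import Summits.KontsevichZagierPeriods.KontsevichZagierPeriods.Theorems.EffectiveXMapChains.Negative.LimitValue
import Summits.KontsevichZagierPeriods.KontsevichZagierPeriods.Theorems.XMapPeriodTransfer.Negative.LoadBearingDatum
import Literature.NumberTheory.EllipticCurves.IsogenyFromRationalMap
import Literature.NumberTheory.EllipticCurves.IsogenyRealPeriodProofs
import Literature.NumberTheory.EllipticCurves.RationalIsogenyDegrees

/-!
# `XMapKernel`, line `isogeny-orbit-collapse` — stub **V**: orbit collapse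

Support file for the crux `IsogenyCertificates.XMapKernel` (stmt-KontsevichZagierPeriods-10663), line
`isogeny-orbit-collapse`, stub `stub_orbitCollapse`.

**Statement.** Along an x-rational isogeny datum `(f, g, c)` between the nonsingular integral short
Weierstrass cubics `y² = P := x³ + Ax + B` and `y² = Q := x³ + A'x + B'` (`W := f'g − fg' ≠ 0`,
`c²·g·(f³ + A'fg² + B'g³) = P·W²`), the full real periods `Ω(A, B) = ∫_{P>0} dx/√P` and
`Ω(A', B')` have a POSITIVE RATIONAL ratio.

**Proof** (no real-analytic sheet counting; the tree's elliptic-curve library instead).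
1. *Normalisation* (`exists_datum_natDegree_lt`): one may assume `deg g < deg f`. If
   `deg f ≤ deg g` then `e := R(∞) ∈ ℚ` (`R = f/g`) is a root of `Q` (the tree's
   `limit_value_is_root`), a simple one (`4A'³ + 27B'² ≠ 0`, so `3e² + A' ≠ 0`), and composing the
   x-map with the translation by the rational `2`-torsion point `(e, 0)` of the target,
   `X ↦ (eX + 2e² + A')/(X − e)`, gives the new datum `(ef + (2e² + A')g, f − eg, c)` with
   Wronskian `−(3e² + A')·W` and `deg (f − eg) < deg g = deg (ef + (2e² + A')g)`; its datum identity
   is a polynomial identity (`linear_combination`).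
2. *The isogeny* (`nonempty_isogenyFormula`): a datum with `deg g < deg f` is a tree
   `WeierstrassCurve.IsogenyFormula ⟨0,0,0,A,B⟩ ⟨0,0,0,A',B'⟩` over `ℚ` (`U = fg`, `h = g`,
   `S = c⁻¹·W·g`, `T = 0`; `identity₀` is the datum identity times `g²/c²`), hence a tree `Isogeny`
   (`IsogenyFormula.toIsogeny`, Silverman *AEC* III.4.8, proved in the tree).
3. *The archimedean factor* (`realPeriod_ratio`): the tree's
   `Isogeny.exists_algebraMap_card_ker_inf_realPoints_mul_realPeriod_eq` (Milne *ADT* I.7) gives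
   `k ∈ ℚˣ` with `#ker · Ω(A', B') = [coker] · |k| · Ω(A, B)`; the kernel of the base-changed isogeny
   is finite (`finite_ker_baseChange`), so `#ker ≥ 1`, whence `[coker] ≠ 0` and
   `Ω(A, B) = q · Ω(A', B')` with `q = #ker / ([coker]·|k|) ∈ ℚ_{>0}`.
4. *Bridge* to the stub's `Fin 1`-integrals: the tree's `setIntegral_rep` (`∫_{P>0} 1/√P = Ω`) and
   `⟨0,0,0,A,B⟩.baseChange ℝ = curve A B`.

References: Silverman, *The Arithmetic of Elliptic Curves* (2009), III.4.8, III.5; Milne,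
*Arithmetic Duality Theorems* (2006), I.7; Kontsevich–Zagier, *Periods* (2001), §1.1.
-/

noncomputable section

namespace Summit.KontsevichZagierPeriods.IsogenyCertificates.XMapKernelStubs.OrbitCollapse

open Polynomial Set MeasureTheory
open Summit.KontsevichZagierPeriods.IsogenyCertificates.EffectiveXMapChainsNegative
open Summit.KontsevichZagierPeriods.IsogenyCertificates.XMapPeriodTransferDatum

/-! ## §1 The short Weierstrass model `⟨0, 0, 0, A, B⟩` over `ℚ`

No new definitions: the `ℚ`-model of `y² = x³ + Ax + B` is written inline as the structure
`(⟨0, 0, 0, A, B⟩ : WeierstrassCurve ℚ)` (elliptic for `4A³ + 27B² ≠ 0` by the tree's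
`Literature.NumberTheory.EllipticCurves.isElliptic_of_short_disc_ne_zero`); its base change to `ℝ`
is the tree's real model `curve A B`. -/

/-- The base change of the `ℚ`-model to `ℝ` is the tree's real model `curve A B`. [folklore] -/
lemma curveQ_baseChange (A B : ℤ) :
    (⟨0, 0, 0, (A : ℚ), (B : ℚ)⟩ : WeierstrassCurve ℚ).baseChange ℝ = curve A B := by
  ext <;> simp [curve, WeierstrassCurve.baseChange]

/-! ## §2 A datum with `deg g < deg f` is an isogeny formula -/

/-- **The isogeny formula of a datum.** For a datum `(f, g, c)` from `(A, B)` to `(A', B')` with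
`deg g < deg f`, the data `U = fg`, `h = g`, `S = c⁻¹·W·g`, `T = 0` form a tree
`WeierstrassCurve.IsogenyFormula` `y² = x³ + Ax + B → y² = x³ + A'x + B'` over `ℚ`
(`x ↦ f/g = U/h²`, `y ↦ y·W/(c g²) = S y/h³`; `identity₀` is the datum identity times `g²/c²`,
`identity₁` is `0 = 0` as `a₁ = a₃ = 0`, and `deg h² = 2 deg g < deg f + deg g = deg U`).
[cite: SilvermanAEC2009, Thm. III.4.8 (PDF pp. 70–71)] -/
theorem nonempty_isogenyFormula {A B A' B' : ℤ} {f g : ℚ[X]} {c : ℚ}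
    (hW : derivative f * g - f * derivative g ≠ 0)
    (hI : C (c ^ 2) * g * (f ^ 3 + C (A' : ℚ) * f * g ^ 2 + C (B' : ℚ) * g ^ 3) =
      (X ^ 3 + C (A : ℚ) * X + C (B : ℚ)) * (derivative f * g - f * derivative g) ^ 2)
    (hdeg : g.natDegree < f.natDegree) :
    Nonempty (WeierstrassCurve.IsogenyFormula (⟨0, 0, 0, (A : ℚ), (B : ℚ)⟩ : WeierstrassCurve ℚ)
      (⟨0, 0, 0, (A' : ℚ), (B' : ℚ)⟩ : WeierstrassCurve ℚ)) := by
  obtain ⟨hg, hc⟩ := g_ne_zero_and_c_ne_zero hW hI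
  have hf : f ≠ 0 := by
    rintro rfl
    simp at hW
  have hc1 : (C c⁻¹ : ℚ[X]) ^ 2 * C (c ^ 2) = 1 := by
    rw [← C_pow, ← C_mul, inv_pow, inv_mul_cancel₀ (pow_ne_zero 2 hc), C_1]
  -- fields: `U`, `h`, `S`, `T`, `identity₁`, `identity₀`, `h_ne_zero`, `natDegree_lt`
  refine ⟨⟨f * g, g, C c⁻¹ * (derivative f * g - f * derivative g) * g, 0, ?_, ?_, hg, ?_⟩⟩
  · simp only [map_zero, zero_mul, mul_zero, add_zero]
  · simp only [map_zero, zero_mul, mul_zero, add_zero]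
    linear_combination (-(C c⁻¹) ^ 2 * g ^ 2) * hI +
      (g ^ 3 * (f ^ 3 + C (A' : ℚ) * f * g ^ 2 + C (B' : ℚ) * g ^ 3)) * hc1
  · rw [natDegree_pow, natDegree_mul hf hg]
    omega

/-! ## §3 Normalisation: `deg g < deg f` after a rational `2`-torsion translation -/

/-- A simple root `e` of `x³ + A'x + B'`: `4A'³ + 27B'² ≠ 0` and `e³ + A'e + B' = 0` force
`3e² + A' ≠ 0` (the discriminant lies in the ideal `(Q(e), Q'(e))`). [folklore] -/
lemma three_mul_sq_add_ne_zero {A' B' : ℤ} {e : ℚ} (hΔ' : 4 * A' ^ 3 + 27 * B' ^ 2 ≠ 0)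
    (he : e ^ 3 + (A' : ℚ) * e + (B' : ℚ) = 0) : 3 * e ^ 2 + (A' : ℚ) ≠ 0 := by
  intro h3
  have hΔQ : (4 * (A' : ℚ) ^ 3 + 27 * (B' : ℚ) ^ 2) ≠ 0 := by exact_mod_cast hΔ'
  apply hΔQ
  linear_combination (-(18 * (A' : ℚ) * e - 27 * (B' : ℚ))) * he +
    (4 * (A' : ℚ) ^ 2 + 6 * (A' : ℚ) * e ^ 2 - 9 * (B' : ℚ) * e) * h3

/-- **Normalisation of the datum.** Every datum `(f, g, c)` from `(A, B)` to a nonsingular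
`(A', B')` can be replaced by one with `deg g < deg f`: if `deg f ≤ deg g`, the finite value
`e = R(∞)` of `R = f/g` is a rational root of `x³ + A'x + B'` (`limit_value_is_root`), and
composing with the translation `X ↦ (eX + 2e² + A')/(X − e)` by the rational `2`-torsion point
`(e, 0)` of the target (which preserves `dX/Y`) yields the datum `(ef + (2e² + A')g, f − eg, c)`,
whose Wronskian is `−(3e² + A')·W ≠ 0` and whose degrees are `deg (f − eg) < deg g = deg (ef + (2e² + A')g)`.
[cite: SilvermanAEC2009, III.4 (Remark 4.13.2)] -/
theorem exists_datum_natDegree_lt {A B A' B' : ℤ} {f g : ℚ[X]} {c : ℚ}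
    (hΔ' : 4 * A' ^ 3 + 27 * B' ^ 2 ≠ 0)
    (hW : derivative f * g - f * derivative g ≠ 0)
    (hI : C (c ^ 2) * g * (f ^ 3 + C (A' : ℚ) * f * g ^ 2 + C (B' : ℚ) * g ^ 3) =
      (X ^ 3 + C (A : ℚ) * X + C (B : ℚ)) * (derivative f * g - f * derivative g) ^ 2) :
    ∃ (f₂ g₂ : ℚ[X]) (c₂ : ℚ), derivative f₂ * g₂ - f₂ * derivative g₂ ≠ 0 ∧
      C (c₂ ^ 2) * g₂ * (f₂ ^ 3 + C (A' : ℚ) * f₂ * g₂ ^ 2 + C (B' : ℚ) * g₂ ^ 3) =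
        (X ^ 3 + C (A : ℚ) * X + C (B : ℚ)) * (derivative f₂ * g₂ - f₂ * derivative g₂) ^ 2 ∧
      g₂.natDegree < f₂.natDegree := by
  rcases lt_or_ge g.natDegree f.natDegree with hlt | hle
  · exact ⟨f, g, c, hW, hI, hlt⟩
  obtain ⟨hg, hc⟩ := g_ne_zero_and_c_ne_zero hW hI
  have hgc : g.leadingCoeff ≠ 0 := leadingCoeff_ne_zero.mpr hg
  -- the finite value `e = R(∞)`, a simple rational root of the target cubic
  set n := g.natDegree with hn
  set e : ℚ := f.coeff n / g.leadingCoeff with he_def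
  have he : e ^ 3 + (A' : ℚ) * e + (B' : ℚ) = 0 := limit_value_is_root hW hI hc hle
  have h3 : 3 * e ^ 2 + (A' : ℚ) ≠ 0 := three_mul_sq_add_ne_zero hΔ' he
  have hfn : f.coeff n = e * g.leadingCoeff := by rw [he_def, div_mul_cancel₀ _ hgc]
  have hC2 : (C (2 * e ^ 2 + (A' : ℚ)) : ℚ[X]) = 2 * C e ^ 2 + C (A' : ℚ) := by
    simp only [map_add, map_mul, map_pow, map_ofNat]
  have hC3 : (C (3 * e ^ 2 + (A' : ℚ)) : ℚ[X]) = 3 * C e ^ 2 + C (A' : ℚ) := by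
    simp only [map_add, map_mul, map_pow, map_ofNat]
  have hC3ne : (C (3 * e ^ 2 + (A' : ℚ)) : ℚ[X]) ≠ 0 := by
    rwa [Ne, C_eq_zero]
  have hroot : (C (B' : ℚ) : ℚ[X]) + C e ^ 3 + C (A' : ℚ) * C e = 0 := by
    have h0 : (C (e ^ 3 + (A' : ℚ) * e + (B' : ℚ)) : ℚ[X]) = 0 := by rw [he, map_zero]
    rw [map_add, map_add, map_mul, map_pow] at h0
    linear_combination h0
  -- the translated datum and its Wronskian
  have hWeq : derivative (C e * f + C (2 * e ^ 2 + (A' : ℚ)) * g) * (f - C e * g) -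
      (C e * f + C (2 * e ^ 2 + (A' : ℚ)) * g) * derivative (f - C e * g) =
      -C (3 * e ^ 2 + (A' : ℚ)) * (derivative f * g - f * derivative g) := by
    simp only [derivative_add, derivative_sub, derivative_C_mul]
    rw [hC2, hC3]
    ring
  have hW₂ : derivative (C e * f + C (2 * e ^ 2 + (A' : ℚ)) * g) * (f - C e * g) -
      (C e * f + C (2 * e ^ 2 + (A' : ℚ)) * g) * derivative (f - C e * g) ≠ 0 := by
    rw [hWeq]
    exact mul_ne_zero (neg_ne_zero.mpr hC3ne) hW
  refine ⟨C e * f + C (2 * e ^ 2 + (A' : ℚ)) * g, f - C e * g, c, hW₂, ?_, ?_⟩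
  · -- the datum identity of the translate: a polynomial identity modulo `e³ + A'e + B' = 0`
    rw [hWeq, hC2, hC3]
    linear_combination (3 * C e ^ 2 + C (A' : ℚ)) ^ 2 * hI +
      C (c ^ 2) * ((f - C e * g) ^ 4 - (3 * C e ^ 2 + C (A' : ℚ)) ^ 2 * g ^ 4) * hroot
  · -- degrees: `deg (f − e g) < n ≤ deg (e f + (2e² + A') g)`
    have hg₂ : f - C e * g ≠ 0 := by
      intro h0
      apply hW₂
      rw [h0, derivative_zero, mul_zero, mul_zero, sub_self]
    have hlt : (f - C e * g).natDegree < n := by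
      rw [natDegree_lt_iff_degree_lt hg₂, degree_lt_iff_coeff_zero]
      intro m hm
      rw [coeff_sub, coeff_C_mul]
      rcases hm.eq_or_lt with hmn | hmn
      · rw [← hmn, hfn]
        change e * g.leadingCoeff - e * g.coeff g.natDegree = 0
        rw [Polynomial.leadingCoeff, sub_self]
      · rw [coeff_eq_zero_of_natDegree_lt (hle.trans_lt hmn), coeff_eq_zero_of_natDegree_lt hmn]
        ring
    have hge : n ≤ (C e * f + C (2 * e ^ 2 + (A' : ℚ)) * g).natDegree := by
      apply le_natDegree_of_ne_zero
      rw [coeff_add, coeff_C_mul, coeff_C_mul, hfn]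
      change e * (e * g.leadingCoeff) + (2 * e ^ 2 + (A' : ℚ)) * g.leadingCoeff ≠ 0
      have : e * (e * g.leadingCoeff) + (2 * e ^ 2 + (A' : ℚ)) * g.leadingCoeff =
          (3 * e ^ 2 + (A' : ℚ)) * g.leadingCoeff := by ring
      rw [this]
      exact mul_ne_zero h3 hgc
    exact hlt.trans_le hge

/-! ## §4 The archimedean factor: a positive rational ratio of real periods -/

open scoped Classical in
/-- The kernel of the base change `ψ_M` of an isogeny to a field `M ⊇ K̄` is finite: it is the image
of the finite kernel `E[ψ] ⊆ E(K̄)` (generic points are mapped to affine points).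
[cite: SilvermanAEC2009, III.4, Cor. 4.9] -/
theorem finite_ker_baseChange {K : Type*} [Field K] {W W' : WeierstrassCurve K}
    {M : Type*} [Field M] [Algebra K M] [Algebra (AlgebraicClosure K) M]
    [IsScalarTower K (AlgebraicClosure K) M] (φ : WeierstrassCurve.Isogeny W W') :
    ((φ.baseChange (M := M)).ker : Set (W.baseChange M).toAffine.Point).Finite := by
  -- adapted from `WeierstrassCurve.Isogeny.ker_baseChange_eq_map`
  -- (Literature/NumberTheory/EllipticCurves/IsogenyRationalPointsBaseChangeProofs.lean)
  refine (φ.finite_ker.image (WeierstrassCurve.Affine.Point.map (W' := W)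
    (IsScalarTower.toAlgHom K (AlgebraicClosure K) M))).subset ?_
  intro R hR
  replace hR : φ.baseChange R = 0 := hR
  by_cases hmem : R ∈ Set.range
      (WeierstrassCurve.Affine.Point.map (W' := W) (IsScalarTower.toAlgHom K (AlgebraicClosure K) M))
  · obtain ⟨P₀, rfl⟩ := hmem
    refine ⟨P₀, ?_, rfl⟩
    rw [φ.baseChange_map] at hR
    change φ P₀ = 0
    exact WeierstrassCurve.Affine.Point.map_injective _ (hR.trans rfl)
  · exfalso
    rcases R with _ | ⟨x, y, hxy⟩
    · exact hmem ⟨0, by rw [← WeierstrassCurve.Affine.Point.zero_def, map_zero]⟩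
    · rw [φ.baseChange_apply, φ.baseChangeFun_some_of_generic hxy hmem] at hR
      exact WeierstrassCurve.Affine.Point.some_ne_zero _ hR

/-- `ker φ ∩ S` is a nonempty finite group when `ker φ` is finite, so its `Nat.card` is positive.
[folklore] -/
lemma card_ker_inf_pos {G H : Type*} [AddCommGroup G] [AddCommGroup H] (φ : G →+ H)
    (hfin : (φ.ker : Set G).Finite) (S : AddSubgroup G) : 0 < Nat.card ↥(φ.ker ⊓ S) := by
  haveI : Finite ↥(φ.ker ⊓ S) :=
    (hfin.subset (fun x hx => (AddSubgroup.mem_inf.mp hx).1)).to_subtype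
  exact Nat.card_pos

/-- Bookkeeping: `N·Ω₂ = M·|k|·Ω₁` with `N ≥ 1`, `k ∈ ℚˣ`, `Ω₁, Ω₂ > 0` gives `Ω₁ = q·Ω₂` with
`q = N/(M|k|) ∈ ℚ_{>0}` (it forces `M ≠ 0`). [folklore] -/
lemma ratio_of_count {N M : ℕ} {k : ℚ} {Ω₁ Ω₂ : ℝ} (hN : 0 < N) (hΩ₂ : 0 < Ω₂)
    (hk : k ≠ 0) (h : (N : ℝ) * Ω₂ = (M : ℝ) * |(k : ℝ)| * Ω₁) :
    ∃ q : ℚ, 0 < q ∧ Ω₁ = (q : ℝ) * Ω₂ := by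
  have hM : 0 < M := by
    rcases Nat.eq_zero_or_pos M with hM0 | hMpos
    · exfalso
      rw [hM0, Nat.cast_zero, zero_mul, zero_mul] at h
      have : (0 : ℝ) < (N : ℝ) * Ω₂ := mul_pos (Nat.cast_pos.mpr hN) hΩ₂
      linarith
    · exact hMpos
  have hkℝ : (0 : ℝ) < |(k : ℝ)| := abs_pos.mpr (by exact_mod_cast hk)
  have hMℝ : (0 : ℝ) < (M : ℝ) := Nat.cast_pos.mpr hM
  refine ⟨(N : ℚ) / ((M : ℚ) * |k|),
    div_pos (Nat.cast_pos.mpr hN) (mul_pos (Nat.cast_pos.mpr hM) (abs_pos.mpr hk)), ?_⟩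
  push_cast
  field_simp
  linear_combination -h

open scoped Classical in
/-- **Orbit collapse for the real periods** (the heart of stub V). For nonsingular `(A, B)`,
`(A', B')` and a datum `(f, g, c)` with `deg g < deg f`, the real periods satisfy
`Ω(A, B) = q · Ω(A', B')` for a positive rational `q`: the datum is an isogeny formula, hence an
isogeny `ψ` over `ℚ` (AEC III.4.8), and the archimedean factor of `ψ` (Milne *ADT* I.7:
`#ker · Ω' = [coker] · |k| · Ω`, `k ∈ ℚˣ`, `#ker ≥ 1`) gives `q = #ker/([coker]·|k|)`.
[cite: MilneADT2006, Ch. I §7, proof of Thm. 7.3, p. 98] -/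
theorem realPeriod_ratio {A B A' B' : ℤ} {f g : ℚ[X]} {c : ℚ}
    (hΔ : 4 * A ^ 3 + 27 * B ^ 2 ≠ 0) (hΔ' : 4 * A' ^ 3 + 27 * B' ^ 2 ≠ 0)
    (hW : derivative f * g - f * derivative g ≠ 0)
    (hI : C (c ^ 2) * g * (f ^ 3 + C (A' : ℚ) * f * g ^ 2 + C (B' : ℚ) * g ^ 3) =
      (X ^ 3 + C (A : ℚ) * X + C (B : ℚ)) * (derivative f * g - f * derivative g) ^ 2)
    (hdeg : g.natDegree < f.natDegree) :
    ∃ q : ℚ, 0 < q ∧ (curve A B).realPeriod = (q : ℝ) * (curve A' B').realPeriod := by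
  haveI := Literature.NumberTheory.EllipticCurves.isElliptic_of_short_disc_ne_zero hΔ
  haveI := Literature.NumberTheory.EllipticCurves.isElliptic_of_short_disc_ne_zero hΔ'
  haveI hQbar : Algebra.IsAlgebraic ℚ (AlgebraicClosure ℚ) := AlgebraicClosure.isAlgebraic ℚ
  letI : Algebra (AlgebraicClosure ℚ) ℂ :=
    (IsAlgClosed.lift : AlgebraicClosure ℚ →ₐ[ℚ] ℂ).toRingHom.toAlgebra
  obtain ⟨φ⟩ := nonempty_isogenyFormula hW hI hdeg
  obtain ⟨k, hk0, hperiod, -⟩ :=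
    φ.toIsogeny.exists_algebraMap_card_ker_inf_realPoints_mul_realPeriod_eq
  have hN := card_ker_inf_pos (φ.toIsogeny.baseChange (M := ℂ))
    (finite_ker_baseChange (M := ℂ) φ.toIsogeny)
    (WeierstrassCurve.Affine.Point.map (W' := (⟨0, 0, 0, (A : ℚ), (B : ℚ)⟩ : WeierstrassCurve ℚ))
      (IsScalarTower.toAlgHom ℚ ℝ ℂ)).range
  have hΩ₁ : ((⟨0, 0, 0, (A : ℚ), (B : ℚ)⟩ : WeierstrassCurve ℚ).baseChange ℝ).realPeriod =
      (curve A B).realPeriod := by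
    rw [curveQ_baseChange]
  have hΩ₂ : ((⟨0, 0, 0, (A' : ℚ), (B' : ℚ)⟩ : WeierstrassCurve ℚ).baseChange ℝ).realPeriod =
      (curve A' B').realPeriod := by
    rw [curveQ_baseChange]
  have hk : algebraMap ℚ ℝ k = (k : ℝ) := eq_ratCast _ _
  rw [hΩ₁, hΩ₂, hk] at hperiod
  exact ratio_of_count hN (realPeriod_pos hΔ') hk0 hperiod

/-! ## §5 The stub -/

/-- **V — orbit collapse.** Along an x-rational isogeny datum `(f, g, c)` between the nonsingular
integral short Weierstrass cubics `y² = x³ + Ax + B` and `y² = x³ + A'x + B'`, the full real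
periods `∫_{P>0} dx/√P` and `∫_{Q>0} dx/√Q` have a positive rational ratio: normalise the datum to
`deg g < deg f` by a rational `2`-torsion translation (`exists_datum_natDegree_lt`), read it as an
isogeny over `ℚ` (AEC III.4.8) and take the archimedean factor of that isogeny (Milne *ADT* I.7),
then pass to the `Fin 1`-integrals by `setIntegral_rep`.
[cite: MilneADT2006, Ch. I §7, proof of Thm. 7.3, p. 98] -/
theorem stub_orbitCollapse : ∀ (A B A' B' : ℤ), 4 * A ^ 3 + 27 * B ^ 2 ≠ 0 → 4 * A' ^ 3 + 27 * B' ^ 2 ≠ 0 → (∃ (f g : Polynomial ℚ) (c : ℚ), Polynomial.derivative f * g - f * Polynomial.derivative g ≠ 0 ∧ Polynomial.C (c ^ 2) * g * (f ^ 3 + Polynomial.C (A' : ℚ) * f * g ^ 2 + Polynomial.C (B' : ℚ) * g ^ 3) = (Polynomial.X ^ 3 + Polynomial.C (A : ℚ) * Polynomial.X + Polynomial.C (B : ℚ)) * (Polynomial.derivative f * g - f * Polynomial.derivative g) ^ 2) → ∃ q : ℚ, 0 < q ∧ (∫ x in {x : Fin 1 → ℝ | 0 < x 0 ^ 3 + (A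 : ℝ) * x 0 + (B : ℝ)}, 1 / Real.sqrt (x 0 ^ 3 + (A : ℝ) * x 0 + (B : ℝ))) = (q : ℝ) * ∫ x in {x : Fin 1 → ℝ | 0 < x 0 ^ 3 + (A' : ℝ) * x 0 + (B' : ℝ)}, 1 / Real.sqrt (x 0 ^ 3 + (A' : ℝ) * x 0 + (B' : ℝ)) := by
  rintro A B A' B' hΔ hΔ' ⟨f, g, c, hW, hI⟩
  obtain ⟨f₂, g₂, c₂, hW₂, hI₂, hdeg⟩ := exists_datum_natDegree_lt hΔ' hW hI
  obtain ⟨q, hq, hΩ⟩ := realPeriod_ratio hΔ hΔ' hW₂ hI₂ hdeg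
  refine ⟨q, hq, ?_⟩
  rw [setIntegral_rep A B 1, setIntegral_rep A' B' 1, one_mul, one_mul, hΩ]

end Summit.KontsevichZagierPeriods.IsogenyCertificates.XMapKernelStubs.OrbitCollapse
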